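import Literature.AnabelianGeometry.SemiGraphs.TemperedAnabelianThm68Sub

/-!
# [SemiAnbd] Rmk. 6.8.1 / [Mzk8] Rmk. 2.8.1 in the Thm. 6.8 sub-DAG: OF-type arrows are transported along `α` (T68-R2), PROVED

Mochizuki, *Semi-graphs of anabelioids* [SemiAnbd], §6 Rmk. 6.8.1, kurims p. 75 ("the proofs of
Theorem 6.8, (iii), (iv), only require the isomorphism version of Theorem 6.4 [cf. [Mzk8], Remark
2.8.1]"); [Mzk8] (*Galois sections in absolute anabelian geometry*) Rmk. 2.8.1, ms. p. 12: the
equivalence `DLoc_{G_K}(Π_{X_K}) ⥲ DLoc_{G_L}(Π_{Y_L})` induced by `α` "maps `OFLoc_K(Π_{X_K})` into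
`OFLoc_L(Π_{Y_L})` by applying Proposition 1.1, (ii); Theorem 1.3, (iii) [i.e., without using
Theorem 1.2 at all!]" — arrows of OF-type = "composite of a surjection `J₁ ↠ J₃` whose kernel is
normally topologically generated by some collection of cuspidal geometric decomposition groups, with
an open immersion `J₃ ↪ J₂`". [cite: MochizukiSemiAnbd2006, Rmk 6.8.1 p.75]
[cite: MochizukiGalSect2005, Rmk 2.8.1 p.12]

Proof-only companion (abc-iut cell, layer L3, seat abc-iut-w5-d040) to `TemperedAnabelianThm68Sub.lean`
(sub-DAG row T68-R2, `Thm68Sub.OFRepsTransported`): for abc-iut-L3-t4's transport of representatives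
`DLocObj.HomRep.transport α hI hΔ` (`TemperedDLocTransport.lean`) — `ψ = j_B ∘ φ ∘ j_A⁻¹` with the
induced isomorphisms `j : J ⥲ α(H)/α(N)` — the kernel of `ψ` is `j_A(Ker φ)`, the closure of the
normal closure of the images of the TRANSPORTED generators (which are again `α(H) ∩` cuspidal geometric
decomposition groups of `Π^temp_{Y_L}` by (hI) = [SemiAnbd] Thm. 6.5 (iii)), and the image of `ψ` is
`j_B(Im φ)`, again open of finite index.  Pure group theory/topology; nothing of [SemiAnbd]/[Mzk8] is
asserted; nothing here takes a side on [IUTchIII] Cor. 3.12.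
-/

noncomputable section

namespace Literature.AnabelianGeometry.SemiGraphs

open scoped Pointwise
open CategoryTheory Topology

variable {p : ℕ} [Fact p.Prime]

namespace Thm68Sub

variable {X Y : TemperedCurve p} (α : X.PiTemp ≃ₜ* Y.PiTemp)
  (hI : ∀ I : Subgroup X.PiTemp, X.IsCuspidalGeometricDecompositionGroup I →
    Y.IsCuspidalGeometricDecompositionGroup (I.map α.toMulEquiv.toMonoidHom))
  (hΔ : X.DeltaTemp.map α.toMulEquiv.toMonoidHom = Y.DeltaTemp)

/-- The kernel of the transported representative `ψ = j_B ∘ φ ∘ j_A⁻¹` is `j_A(Ker φ)`.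
[cite: MochizukiGalSect2005, Rmk 2.8.1 p.12] -/
private theorem ker_transport {A B : DLocObj X} (φ : DLocObj.HomRep A B) :
    (φ.transport α hI hΔ).toHom.toMonoidHom.ker =
      φ.toHom.toMonoidHom.ker.map (DLocObj.jIso α hI hΔ A).toMulEquiv.toMonoidHom := by
  ext x'
  rw [MonoidHom.mem_ker]
  change (φ.transport α hI hΔ).toHom x' = 1 ↔ _
  rw [DLocObj.HomRep.transport_toHom_apply, map_eq_one_iff _ (DLocObj.jIso α hI hΔ B).injective]
  constructor
  · intro h
    refine ⟨(DLocObj.jIso α hI hΔ A).symm x', (MonoidHom.mem_ker).2 h, ?_⟩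
    exact (DLocObj.jIso α hI hΔ A).apply_symm_apply x'
  · rintro ⟨x, hx, rfl⟩
    have hx' : φ.toHom x = 1 := hx
    change φ.toHom ((DLocObj.jIso α hI hΔ A).symm (DLocObj.jIso α hI hΔ A x)) = 1
    rwa [ContinuousMulEquiv.symm_apply_apply]

/-- The image of the transported representative `ψ = j_B ∘ φ ∘ j_A⁻¹` is `j_B(Im φ)`.
[cite: MochizukiGalSect2005, Rmk 2.8.1 p.12] -/
private theorem range_transport {A B : DLocObj X} (φ : DLocObj.HomRep A B) :
    (φ.transport α hI hΔ).toHom.toMonoidHom.range =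
      φ.toHom.toMonoidHom.range.map (DLocObj.jIso α hI hΔ B).toMulEquiv.toMonoidHom := by
  ext y
  constructor
  · rintro ⟨x', rfl⟩
    refine ⟨φ.toHom ((DLocObj.jIso α hI hΔ A).symm x'), ⟨_, rfl⟩, ?_⟩
    exact (DLocObj.HomRep.transport_toHom_apply α hI hΔ φ x').symm
  · rintro ⟨_, ⟨x, rfl⟩, rfl⟩
    refine ⟨DLocObj.jIso α hI hΔ A x, ?_⟩
    change (φ.transport α hI hΔ).toHom _ = _
    rw [DLocObj.HomRep.transport_toHom_apply, ContinuousMulEquiv.symm_apply_apply]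
    rfl

/-- `j_A` carries the generating set of images of `gens` in `J_A` onto the generating set of images of
the transported generators in `J_{A'}`. [cite: MochizukiGalSect2005, Rmk 2.8.1 p.12] -/
private theorem image_jIso_gens (A : DLocObj X) (gens : Set (Subgroup X.PiTemp)) :
    (DLocObj.jIso α hI hΔ A) ''
        (⋃ I ∈ gens, (((I.subgroupOf A.H).map A.proj.toMonoidHom : Subgroup A.J) : Set A.J)) =
      ⋃ I' ∈ (fun I : Subgroup X.PiTemp => I.map α.toMulEquiv.toMonoidHom) '' gens,
        (((I'.subgroupOf (A.transport α hI hΔ).H).map (A.transport α hI hΔ).proj.toMonoidHom :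
          Subgroup (A.transport α hI hΔ).J) : Set (A.transport α hI hΔ).J) := by
  ext y
  simp only [Set.mem_image, Set.mem_iUnion, SetLike.mem_coe, Subgroup.mem_map,
    Subgroup.mem_subgroupOf, exists_prop]
  constructor
  · rintro ⟨j, ⟨I, hIg, h, hh, rfl⟩, rfl⟩
    refine ⟨I.map α.toMulEquiv.toMonoidHom, ⟨I, hIg, rfl⟩, DLocObj.subgroupIso α A.H h, ?_, ?_⟩
    · exact ⟨(h : X.PiTemp), hh, rfl⟩
    · rfl
  · rintro ⟨_, ⟨I, hIg, rfl⟩, h', ⟨x, hx, hxe⟩, rfl⟩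
    refine ⟨A.proj ((DLocObj.subgroupIso α A.H).symm h'), ⟨I, hIg, (DLocObj.subgroupIso α A.H).symm h',
      ?_, rfl⟩, ?_⟩
    · have : (((DLocObj.subgroupIso α A.H).symm h' : A.H) : X.PiTemp) = x := by
        apply α.injective
        change α (α.symm (h' : Y.PiTemp)) = α x
        rw [α.apply_symm_apply]
        exact hxe.symm
      rw [this]; exact hx
    · exact (by rw [DLocObj.jIso_mk, ContinuousMulEquiv.apply_symm_apply]; rfl :
        DLocObj.jIso α hI hΔ A (QuotientGroup.mk ((DLocObj.subgroupIso α A.H).symm h')) =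
          QuotientGroup.mk h')

/-- **T68-R2 PROVED**: `Thm68Sub.OFRepsTransported X Y α hI hΔ` — OF-type representatives go to OF-type
representatives under abc-iut-L3-t4's transport along `α` ([Mzk8] Rmk. 2.8.1: "maps `OFLoc_K(Π_{X_K})`
into `OFLoc_L(Π_{Y_L})` … without using Theorem 1.2 at all"; the only inputs are (hI) = [SemiAnbd]
Thm. 6.5 (iii) for cuspidal geometric decomposition groups and (hΔ)). [cite: MochizukiGalSect2005, Rmk 2.8.1 p.12] -/
theorem ofRepsTransported_holds : OFRepsTransported X Y α hI hΔ := by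
  intro A B φ hφ
  obtain ⟨⟨gens, hgens, hker⟩, hopen, hfi⟩ := hφ
  refine ⟨⟨(fun I : Subgroup X.PiTemp => I.map α.toMulEquiv.toMonoidHom) '' gens, ?_, ?_⟩, ?_, ?_⟩
  · -- the transported generators are `α(H) ∩` (cuspidal geometric decomposition groups of `Π^temp_{Y_L}`)
    rintro _ ⟨I, hIg, rfl⟩
    obtain ⟨I₀, h₀, rfl⟩ := hgens I hIg
    exact ⟨I₀.map α.toMulEquiv.toMonoidHom, hI I₀ h₀, Subgroup.map_inf _ _ _ α.injective⟩
  · -- the kernel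
    rw [ker_transport, hker, DLocObj.map_topologicalClosure_equiv,
      Subgroup.map_normalClosure _ (DLocObj.jIso α hI hΔ A).toMulEquiv.toMonoidHom
        (DLocObj.jIso α hI hΔ A).surjective]
    congr 2
    exact image_jIso_gens α hI hΔ A gens
  · -- the image is open
    rw [range_transport, Subgroup.coe_map]
    exact (DLocObj.jIso α hI hΔ B).toHomeomorph.isOpenMap _ hopen
  · -- the image has finite index
    rw [range_transport]
    haveI := hfi
    exact ⟨by
      rw [Subgroup.index_map_of_bijective (f := (DLocObj.jIso α hI hΔ B).toMulEquiv.toMonoidHom)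
        (DLocObj.jIso α hI hΔ B).bijective]
      exact Subgroup.FiniteIndex.index_ne_zero⟩

end Thm68Sub

end Literature.AnabelianGeometry.SemiGraphs

end
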